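import Summits.BirchSwinnertonDyer.BirchSwinnertonDyer.Theorems.QuadraticBranchSignedControlPlusEtaNonsurjCMAnchorTransfer
import Summits.BirchSwinnertonDyer.BirchSwinnertonDyer.Theorems.QuadraticBranchSignedControlPlusEtaNonsurjCorpuzLeiTransferOPEN
import Summits.BirchSwinnertonDyer.BirchSwinnertonDyer.Theorems.QuadraticBranchSignedControlPlusEtaNonsurjModFiveCongruenceRecordsB
import Summits.BirchSwinnertonDyer.BirchSwinnertonDyer.Theorems.QuadraticBranchSignedControlPlusEtaNonsurjModFiveCongruenceRecordsC
import Summits.BirchSwinnertonDyer.BirchSwinnertonDyer.Theorems.QuadraticBranchSignedControlPlusEtaNonsurjModFiveCongruenceRecordsD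
import Summits.BirchSwinnertonDyer.BirchSwinnertonDyer.Theorems.QuadraticBranchSignedControlPlusEtaNonsurjFineRoadRecordsC
import Summits.BirchSwinnertonDyer.BirchSwinnertonDyer.Theorems.QuadraticBranchSignedControlPlusEtaNonsurjFineRoadRecordsD
import Summits.BirchSwinnertonDyer.BirchSwinnertonDyer.Theorems.QuadraticBranchSignedControlPlusEtaNonsurjFineRoadRecordsE
import Summits.BirchSwinnertonDyer.BirchSwinnertonDyer.Theorems.QuadraticBranchSignedControlPlusEtaNonsurjPrimeLFunctionRecordsA
import Summits.BirchSwinnertonDyer.BirchSwinnertonDyer.Theorems.QuadraticBranchSignedControlPlusEtaNonsurjPrimeLFunctionRecordsB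
import Summits.BirchSwinnertonDyer.BirchSwinnertonDyer.Theorems.QuadraticBranchSignedControlPlusEtaNonsurjCMAnchorTransferRecordsA
import HarnessLib

/-!
# Route `QuadraticBranchSignedControl` (rung K8, cell `bsd-potss`), residual crux `PlusEtaMainConjectureNonsurj`
# (stmt-BirchSwinnertonDyer-19606): the CM-UNIT-ANCHOR TRANSFER RECORDS — (C1⁺_η) at `p = 5` per row for the NON-CM rows of
# the crux below `5·10⁵`, part D: 7 rank-1 rows (a `--supports` file; seat `bsd-potss-k8eta-c2` g8; nothing booked, BSD is not proved by any of this)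

WHAT. Crux 19606 has 30 non-CM rows below `5·10⁵` (all `p = 5`, image `C_ns⁺(5)`; 12 of rank 0, 16 of rank 1, 2 of rank 2;
HOME/k8eta-c2/g3/nononto_rows.tsv). EVERY one of them is `5`-congruent to a CM UNIT ANCHOR `A` (CM, `r_an = 0`, `#Ш_an = 1`,
`5 ∤ Tam(A)`: `900b1`, `3600bb1`, `10800cj1`, `11025e1`, `14400cz1`, or the unit siblings `[0,0,0,0,−675]`, `[0,0,1,0,−169]`,
`[0,0,0,0,800]`, `[0,0,1,0,−405169]`), by an explicit point of one of Fisher's Hesse families — this seat's census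
`pub/bsd-potss/k8eta-c2/g8/K8-CM-UNIT-ANCHORS-k8eta-c2-g8.tsv` (30/30) and kernel records `EtaModFiveCongruenceRecords.modPCongruent_twist5_*`
(parts B/C/D; conditional on Fisher's published Thm. 13.2 / Thm. 5.8 only). THIS FILE instantiates the CM-unit-anchor transfer
road `EtaCMAnchorTransfer.quadraticBranchPlusEtaMainConjectureAt_of_cmUnitAnchor_of_transferFrame` per row: Kobayashi's even
main conjecture at `η` for every good `a_5 = 0` globally minimal model `V` of the row's `5`-twist, GIVEN a good `a_5 = 0` globally
minimal model `V′` of the anchor's `5`-twist, MODULO the OPEN binder `hCL` (`CorpuzLei2025_etaPlusMainConjecture_transfer_OPEN`; Corpuz–Lei arXiv:2508.09733 Thms 1–3 at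
`i = (p−1)/2` — PREPRINT, `[claim: …, status: under-review]`), the named facts modularity / GZK / Burungale–Flach bsd.S28 /
one Fisher fact, and per row ONLY the anchor's displayed `L(A,1) ≠ 0`, `#Ш(A)_an = 1`, `5 ∤ Tam(A)`. In particular the four rows
where the Eisenstein stub `stub_etaMC_nonCM_lower` kept open content in-table after g7 — `242325g1`, `404325g1` (rank 1, non-prime
`L_5⁺`) and `162675m1`, `242325h1` (rank 2) — are settled in shape here exactly like the others.

HONEST FRAMING (cell `bsd-potss`; HUMAN RULING D-0036/D-0074): BOOKKEEPING THEOREMS ONLY — no definition, no new fact, no `sorry`,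
axioms standard; CONDITIONAL on `hCL` (an unrefereed preprint read through the flagged dictionary `CL25-eta-plus-dictionary`) and
on the named facts in hypothesis position. 19606 stays OPEN (CM rows; class-wide the non-CM rows without a CM unit anchor; the
binder is PRE); no stub is proved by name; nothing is booked; BSD(W,5) is claimed for no pair; no label / mark / count moves.
`--supports stmt-BirchSwinnertonDyer-19606`.

References: [CorpuzLei2025] Thms 1–3 (claim; hypothesis only); [GreenbergVatsal2000] Thm. (1.4); [Kobayashi2003] §4 (p. 8);
[BurungaleFlach2024] Thm. 1.1, Cor. 2; [Fisher2012Hessian] Thm. 13.2; [Fisher2013TwistsOfX5] Thm. 5.8; [Cremona1997] Table 1.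
-/

set_option autoImplicit false
set_option linter.dupNamespace false

noncomputable section

open scoped Classical

open CongruenceSubgroup Field Function NumberField IsDedekindDomain WeierstrassCurve
open Literature.NumberTheory.EllipticCurves
open Literature.NumberTheory.EllipticCurves.ModularForms
open Literature.NumberTheory.EllipticCurves.Rank1Residual
open Literature.NumberTheory.EllipticCurves.Rank1Residual.Typed
open Literature.NumberTheory.GaloisRepresentations
open Literature.NumberTheory.GaloisCohomology
open Literature.NumberTheory.EllipticCurves.IwasawaAlgebra
open Literature.NumberTheory.EllipticCurves.IwasawaDual ZpExtension
open Literature.NumberTheory.EllipticCurves.GreenbergVatsal2000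
open Literature.NumberTheory.EllipticCurves.HesseFamilyFive (thm132_geomTorsionFive_of_hesseFamily
  thm58_geomTorsionFive_of_dualHesseFamily)
open Summit.BirchSwinnertonDyer.Rank1Residual.X11b.Levels
open Summit.BirchSwinnertonDyer.Rank1Residual.X11b
open Summit.BirchSwinnertonDyer.Rank1Residual.Additive
open Summit.BirchSwinnertonDyer.Rank1Residual.Additive.SignedTwist
open scoped ContRepresentation
open Summit.BirchSwinnertonDyer.Rank1Residual.AdditivePotMult
open Summit.BirchSwinnertonDyer.Rank1Residual.O6 (ModPCongruent)

namespace Summit.BirchSwinnertonDyer.BirchSwinnertonDyer.Theorems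

namespace EtaCMAnchorTransferRecords

set_option maxRecDepth 100000 in
/-- **(C1⁺_η) at `p = 5` for every good `a_5 = 0` globally minimal model `V` of the `5`-twist of `313200el1`**
(`[0, 0, 0, -705375, -135465750]`; non-CM, `Im ρ̄ = C_ns⁺(5)`, rank `1`; Cremona: `Tam = 10`, `#Ш_an = 1`) BY THE CM-UNIT-ANCHOR
TRANSFER ROAD: the row is `5`-congruent to `10800cj1` = `[0,0,0,0,−500]` (CM, `r_an = 0`, `#Ш_an = 1`, `Tam = 4`; displayed
`hLA hm htam`) — on the twist side the congruence `V′[5] ≃ V[5]` for ALL models is the kernel record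
`EtaModFiveCongruenceRecords.modPCongruent_twist5_10800cj1_313200el1` (the twisted row is the point `(λ:μ) = (-600 : 1)` of the
DIRECT Hesse family of the twisted anchor), conditional on Fisher's `thm132_geomTorsionFive_of_hesseFamily` only; at the
anchor's twist (C1⁺_η) and `μ = 0` are TREE THEOREMS (`EtaUnitRows`, `EtaMuBound`; mod `hmod hGZK hS28`); the transfer is the
OPEN binder `hCL` (Corpuz–Lei 2025 Thms 1–3 at `i = (p−1)/2`, PREPRINT). NO hypothesis on the row beyond its model: no rank, no
`L`-value, no shape of `L_5⁺`, no analytic `μ`, no Kobayashi Thm. 2.2/4.1, no Hatley–Lei, no Poitou–Tate, no Kitajima–Otsuki, no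
(A), no `L₀`. Per-row instance of `EtaCMAnchorTransfer.quadraticBranchPlusEtaMainConjectureAt_of_cmUnitAnchor_of_transferFrame`;
CONDITIONAL on `hCL` (PRE) and the named facts; nothing booked; BSD(W,5) claimed for no pair.
[claim: CorpuzLei2025, status: under-review] [cite: Fisher2012Hessian, Thm. 13.2 (i)]
[cite: Kobayashi2003, §4 Even main conjecture (p. 8)] [cite: GreenbergVatsal2000, Thm. (1.4)]
[cite: BurungaleFlach2024, Thm. 1.1 and Cor. 2] [cite: Cremona1997, Table 1 (label 313200el1)] -/
theorem etaMC_313200el1_5_cmAnchorTransfer (hCL : CorpuzLei2025_etaPlusMainConjecture_transfer_OPEN)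
    (hmod : hasEntireLFunction_rat) (hGZK : rank_eq_analyticRank_of_analyticRank_le_one)
    (hS28 : bsdTriple_of_hasCM_of_L_one_ne_zero) (hF : thm132_geomTorsionFive_of_hesseFamily)
    (W : WeierstrassCurve ℚ) (hW : W = ⟨0, 0, 0, (-705375), (-135465750)⟩) (A : WeierstrassCurve ℚ) (hA : A = ⟨0, 0, 0, 0, (-500)⟩)
    (hLA : A.entireLFunction 1 ≠ 0) (hm : shaAn A = ((1 : ℕ) : ℂ)) (htam : ¬ 5 ∣ A.tamagawaProduct) :
    ∀ (V' : WeierstrassCurve ℚ) [V'.IsElliptic] [V'.IsGloballyMinimal]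
      (V : WeierstrassCurve ℚ) [V.IsElliptic] [V.IsGloballyMinimal] [Fact (5 : ℕ).Prime],
      (∃ C' : VariableChange ℚ, C' • A.quadraticTwist (5) = V') →
      V'.HasGoodReductionAtPrime 5 → V'.frobeniusTrace 5 = 0 →
      (∃ C : VariableChange ℚ, C • W.quadraticTwist (5) = V) →
      V.HasGoodReductionAtPrime 5 → V.frobeniusTrace 5 = 0 →
      QuadraticBranchPlusEtaMainConjectureAt V 5 := by
  intro V' _ _ V _ _ _ hC' hgood' hap' hC hgood hap
  subst hW; subst hA
  haveI := EtaCMUnitRecords.isElliptic_10800cj1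
  haveI := EtaCMUnitRecords.isGloballyMinimal_10800cj1
  haveI := EtaPrimeRoadRecords.isElliptic_313200el1
  have hcong : ModPCongruent V' V 5 :=
    EtaModFiveCongruenceRecords.modPCongruent_twist5_10800cj1_313200el1 hF _ _ rfl rfl V' V hC' hC
  obtain ⟨C', hC'V'⟩ := hC'
  have hD : ((-1 : ℚ) ^ ((5 : ℕ) / 2) * ((5 : ℕ) : ℚ)) = 5 := by norm_num
  exact EtaCMAnchorTransfer.quadraticBranchPlusEtaMainConjectureAt_of_cmUnitAnchor_of_transferFrame 5 hCL hmod hGZK hS28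
    (le_refl 5) _ hasCM_10800cj1 hLA ⟨1, by exact_mod_cast hm, by simp⟩ htam V' C' (by rw [hD]; exact hC'V') hgood' hap' V hgood
    hap hcong

set_option maxRecDepth 100000 in
/-- **(C1⁺_η) at `p = 5` for every good `a_5 = 0` globally minimal model `V` of the `5`-twist of `341775ca1`**
(`[0, 0, 1, -189000, -1222594]`; non-CM, `Im ρ̄ = C_ns⁺(5)`, rank `1`; Cremona: `Tam = 20`, `#Ш_an = 1`) BY THE CM-UNIT-ANCHOR
TRANSFER ROAD: the row is `5`-congruent to `11025e1` = `[0,0,1,0,−525219]` (CM, `r_an = 0`, `#Ш_an = 1`, `Tam = 2`; displayed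
`hLA hm htam`) — on the twist side the congruence `V′[5] ≃ V[5]` for ALL models is the kernel record
`EtaModFiveCongruenceRecords.modPCongruent_twist5_11025e1_341775ca1` (the twisted row is the point `(λ:μ) = (14700 : 1)` of the
DIRECT Hesse family of the twisted anchor), conditional on Fisher's `thm132_geomTorsionFive_of_hesseFamily` only; at the
anchor's twist (C1⁺_η) and `μ = 0` are TREE THEOREMS (`EtaUnitRows`, `EtaMuBound`; mod `hmod hGZK hS28`); the transfer is the
OPEN binder `hCL` (Corpuz–Lei 2025 Thms 1–3 at `i = (p−1)/2`, PREPRINT). NO hypothesis on the row beyond its model: no rank, no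
`L`-value, no shape of `L_5⁺`, no analytic `μ`, no Kobayashi Thm. 2.2/4.1, no Hatley–Lei, no Poitou–Tate, no Kitajima–Otsuki, no
(A), no `L₀`. Per-row instance of `EtaCMAnchorTransfer.quadraticBranchPlusEtaMainConjectureAt_of_cmUnitAnchor_of_transferFrame`;
CONDITIONAL on `hCL` (PRE) and the named facts; nothing booked; BSD(W,5) claimed for no pair.
[claim: CorpuzLei2025, status: under-review] [cite: Fisher2012Hessian, Thm. 13.2 (i)]
[cite: Kobayashi2003, §4 Even main conjecture (p. 8)] [cite: GreenbergVatsal2000, Thm. (1.4)]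
[cite: BurungaleFlach2024, Thm. 1.1 and Cor. 2] [cite: Cremona1997, Table 1 (label 341775ca1)] -/
theorem etaMC_341775ca1_5_cmAnchorTransfer (hCL : CorpuzLei2025_etaPlusMainConjecture_transfer_OPEN)
    (hmod : hasEntireLFunction_rat) (hGZK : rank_eq_analyticRank_of_analyticRank_le_one)
    (hS28 : bsdTriple_of_hasCM_of_L_one_ne_zero) (hF : thm132_geomTorsionFive_of_hesseFamily)
    (W : WeierstrassCurve ℚ) (hW : W = ⟨0, 0, 1, (-189000), (-1222594)⟩) (A : WeierstrassCurve ℚ) (hA : A = ⟨0, 0, 1, 0, (-525219)⟩)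
    (hLA : A.entireLFunction 1 ≠ 0) (hm : shaAn A = ((1 : ℕ) : ℂ)) (htam : ¬ 5 ∣ A.tamagawaProduct) :
    ∀ (V' : WeierstrassCurve ℚ) [V'.IsElliptic] [V'.IsGloballyMinimal]
      (V : WeierstrassCurve ℚ) [V.IsElliptic] [V.IsGloballyMinimal] [Fact (5 : ℕ).Prime],
      (∃ C' : VariableChange ℚ, C' • A.quadraticTwist (5) = V') →
      V'.HasGoodReductionAtPrime 5 → V'.frobeniusTrace 5 = 0 →
      (∃ C : VariableChange ℚ, C • W.quadraticTwist (5) = V) →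
      V.HasGoodReductionAtPrime 5 → V.frobeniusTrace 5 = 0 →
      QuadraticBranchPlusEtaMainConjectureAt V 5 := by
  intro V' _ _ V _ _ _ hC' hgood' hap' hC hgood hap
  subst hW; subst hA
  haveI := EtaCMUnitRecords.isElliptic_11025e1
  haveI := EtaCMUnitRecords.isGloballyMinimal_11025e1
  haveI := EtaPrimeRoadRecords.isElliptic_341775ca1
  have hcong : ModPCongruent V' V 5 :=
    EtaModFiveCongruenceRecords.modPCongruent_twist5_11025e1_341775ca1 hF _ _ rfl rfl V' V hC' hC
  obtain ⟨C', hC'V'⟩ := hC'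
  have hD : ((-1 : ℚ) ^ ((5 : ℕ) / 2) * ((5 : ℕ) : ℚ)) = 5 := by norm_num
  exact EtaCMAnchorTransfer.quadraticBranchPlusEtaMainConjectureAt_of_cmUnitAnchor_of_transferFrame 5 hCL hmod hGZK hS28
    (le_refl 5) _ hasCM_11025e1 hLA ⟨1, by exact_mod_cast hm, by simp⟩ htam V' C' (by rw [hD]; exact hC'V') hgood' hap' V hgood
    hap hcong

set_option maxRecDepth 100000 in
/-- **(C1⁺_η) at `p = 5` for every good `a_5 = 0` globally minimal model `V` of the `5`-twist of `341775cf1`**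
(`[0, 0, 1, -9261000, 419349656]`; non-CM, `Im ρ̄ = C_ns⁺(5)`, rank `1`; Cremona: `Tam = 12`, `#Ш_an = 1`) BY THE CM-UNIT-ANCHOR
TRANSFER ROAD: the row is `5`-congruent to the unit sibling `A = [0,0,1,0,−405169]` of the class of `11025b1` (CM, `r_an = 0`,
`#Ш_an = 1`, `Tam = 6`; displayed `hLA hm htam`) — on the twist side the congruence `V′[5] ≃ V[5]` for ALL models is the kernel
record `EtaModFiveCongruenceRecords.modPCongruent_twist5_A11025_341775cf1` (the twisted row is the point `(λ:μ) = (3150 : 1)` of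
the INDIRECT Hesse family of the twisted anchor), conditional on Fisher's `thm58_geomTorsionFive_of_dualHesseFamily` only; at
the anchor's twist (C1⁺_η) and `μ = 0` are TREE THEOREMS (`EtaUnitRows`, `EtaMuBound`; mod `hmod hGZK hS28`); the transfer is
the OPEN binder `hCL` (Corpuz–Lei 2025 Thms 1–3 at `i = (p−1)/2`, PREPRINT). NO hypothesis on the row beyond its model: no rank,
no `L`-value, no shape of `L_5⁺`, no analytic `μ`, no Kobayashi Thm. 2.2/4.1, no Hatley–Lei, no Poitou–Tate, no Kitajima–Otsuki,
no (A), no `L₀`. Per-row instance of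
`EtaCMAnchorTransfer.quadraticBranchPlusEtaMainConjectureAt_of_cmUnitAnchor_of_transferFrame`; CONDITIONAL on `hCL` (PRE) and
the named facts; nothing booked; BSD(W,5) claimed for no pair. [claim: CorpuzLei2025, status: under-review]
[cite: Fisher2013TwistsOfX5, Thm. 5.8] [cite: Kobayashi2003, §4 Even main conjecture (p. 8)]
[cite: GreenbergVatsal2000, Thm. (1.4)] [cite: BurungaleFlach2024, Thm. 1.1 and Cor. 2]
[cite: Cremona1997, Table 1 (label 341775cf1)] -/
theorem etaMC_341775cf1_5_cmAnchorTransfer (hCL : CorpuzLei2025_etaPlusMainConjecture_transfer_OPEN)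
    (hmod : hasEntireLFunction_rat) (hGZK : rank_eq_analyticRank_of_analyticRank_le_one)
    (hS28 : bsdTriple_of_hasCM_of_L_one_ne_zero) (hF : thm58_geomTorsionFive_of_dualHesseFamily)
    (W : WeierstrassCurve ℚ) (hW : W = ⟨0, 0, 1, (-9261000), 419349656⟩) (A : WeierstrassCurve ℚ) (hA : A = ⟨0, 0, 1, 0, (-405169)⟩)
    (hLA : A.entireLFunction 1 ≠ 0) (hm : shaAn A = ((1 : ℕ) : ℂ)) (htam : ¬ 5 ∣ A.tamagawaProduct) :
    ∀ (V' : WeierstrassCurve ℚ) [V'.IsElliptic] [V'.IsGloballyMinimal]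
      (V : WeierstrassCurve ℚ) [V.IsElliptic] [V.IsGloballyMinimal] [Fact (5 : ℕ).Prime],
      (∃ C' : VariableChange ℚ, C' • A.quadraticTwist (5) = V') →
      V'.HasGoodReductionAtPrime 5 → V'.frobeniusTrace 5 = 0 →
      (∃ C : VariableChange ℚ, C • W.quadraticTwist (5) = V) →
      V.HasGoodReductionAtPrime 5 → V.frobeniusTrace 5 = 0 →
      QuadraticBranchPlusEtaMainConjectureAt V 5 := by
  intro V' _ _ V _ _ _ hC' hgood' hap' hC hgood hap
  subst hW; subst hA
  haveI := EtaFineRoadRecords.isElliptic_A11025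
  haveI := EtaFineRoadRecords.isGloballyMinimal_A11025
  haveI := EtaFineRoadRecords.isElliptic_341775cf1
  have hcong : ModPCongruent V' V 5 :=
    EtaModFiveCongruenceRecords.modPCongruent_twist5_A11025_341775cf1 hF _ _ rfl rfl V' V hC' hC
  obtain ⟨C', hC'V'⟩ := hC'
  have hD : ((-1 : ℚ) ^ ((5 : ℕ) / 2) * ((5 : ℕ) : ℚ)) = 5 := by norm_num
  exact EtaCMAnchorTransfer.quadraticBranchPlusEtaMainConjectureAt_of_cmUnitAnchor_of_transferFrame 5 hCL hmod hGZK hS28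
    (le_refl 5) _ EtaFineRoadRecords.hasCM_A11025 hLA ⟨1, by exact_mod_cast hm, by simp⟩ htam V' C' (by rw [hD]; exact hC'V') hgood' hap' V hgood
    hap hcong

set_option maxRecDepth 100000 in
/-- **(C1⁺_η) at `p = 5` for every good `a_5 = 0` globally minimal model `V` of the `5`-twist of `341775dj1`**
(`[0, 0, 1, -21000, 45281]`; non-CM, `Im ρ̄ = C_ns⁺(5)`, rank `1`; Cremona: `Tam = 20`, `#Ш_an = 1`) BY THE CM-UNIT-ANCHOR
TRANSFER ROAD: the row is `5`-congruent to `11025e1` = `[0,0,1,0,−525219]` (CM, `r_an = 0`, `#Ш_an = 1`, `Tam = 2`; displayed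
`hLA hm htam`) — on the twist side the congruence `V′[5] ≃ V[5]` for ALL models is the kernel record
`EtaModFiveCongruenceRecords.modPCongruent_twist5_11025e1_341775dj1` (the twisted row is the point `(λ:μ) = (-7350 : 1)` of the
INDIRECT Hesse family of the twisted anchor), conditional on Fisher's `thm58_geomTorsionFive_of_dualHesseFamily` only; at the
anchor's twist (C1⁺_η) and `μ = 0` are TREE THEOREMS (`EtaUnitRows`, `EtaMuBound`; mod `hmod hGZK hS28`); the transfer is the
OPEN binder `hCL` (Corpuz–Lei 2025 Thms 1–3 at `i = (p−1)/2`, PREPRINT). NO hypothesis on the row beyond its model: no rank, no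
`L`-value, no shape of `L_5⁺`, no analytic `μ`, no Kobayashi Thm. 2.2/4.1, no Hatley–Lei, no Poitou–Tate, no Kitajima–Otsuki, no
(A), no `L₀`. Per-row instance of `EtaCMAnchorTransfer.quadraticBranchPlusEtaMainConjectureAt_of_cmUnitAnchor_of_transferFrame`;
CONDITIONAL on `hCL` (PRE) and the named facts; nothing booked; BSD(W,5) claimed for no pair.
[claim: CorpuzLei2025, status: under-review] [cite: Fisher2013TwistsOfX5, Thm. 5.8]
[cite: Kobayashi2003, §4 Even main conjecture (p. 8)] [cite: GreenbergVatsal2000, Thm. (1.4)]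
[cite: BurungaleFlach2024, Thm. 1.1 and Cor. 2] [cite: Cremona1997, Table 1 (label 341775dj1)] -/
theorem etaMC_341775dj1_5_cmAnchorTransfer (hCL : CorpuzLei2025_etaPlusMainConjecture_transfer_OPEN)
    (hmod : hasEntireLFunction_rat) (hGZK : rank_eq_analyticRank_of_analyticRank_le_one)
    (hS28 : bsdTriple_of_hasCM_of_L_one_ne_zero) (hF : thm58_geomTorsionFive_of_dualHesseFamily)
    (W : WeierstrassCurve ℚ) (hW : W = ⟨0, 0, 1, (-21000), 45281⟩) (A : WeierstrassCurve ℚ) (hA : A = ⟨0, 0, 1, 0, (-525219)⟩)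
    (hLA : A.entireLFunction 1 ≠ 0) (hm : shaAn A = ((1 : ℕ) : ℂ)) (htam : ¬ 5 ∣ A.tamagawaProduct) :
    ∀ (V' : WeierstrassCurve ℚ) [V'.IsElliptic] [V'.IsGloballyMinimal]
      (V : WeierstrassCurve ℚ) [V.IsElliptic] [V.IsGloballyMinimal] [Fact (5 : ℕ).Prime],
      (∃ C' : VariableChange ℚ, C' • A.quadraticTwist (5) = V') →
      V'.HasGoodReductionAtPrime 5 → V'.frobeniusTrace 5 = 0 →
      (∃ C : VariableChange ℚ, C • W.quadraticTwist (5) = V) →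
      V.HasGoodReductionAtPrime 5 → V.frobeniusTrace 5 = 0 →
      QuadraticBranchPlusEtaMainConjectureAt V 5 := by
  intro V' _ _ V _ _ _ hC' hgood' hap' hC hgood hap
  subst hW; subst hA
  haveI := EtaCMUnitRecords.isElliptic_11025e1
  haveI := EtaCMUnitRecords.isGloballyMinimal_11025e1
  haveI := EtaPrimeRoadRecords.isElliptic_341775dj1
  have hcong : ModPCongruent V' V 5 :=
    EtaModFiveCongruenceRecords.modPCongruent_twist5_11025e1_341775dj1 hF _ _ rfl rfl V' V hC' hC
  obtain ⟨C', hC'V'⟩ := hC'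
  have hD : ((-1 : ℚ) ^ ((5 : ℕ) / 2) * ((5 : ℕ) : ℚ)) = 5 := by norm_num
  exact EtaCMAnchorTransfer.quadraticBranchPlusEtaMainConjectureAt_of_cmUnitAnchor_of_transferFrame 5 hCL hmod hGZK hS28
    (le_refl 5) _ hasCM_11025e1 hLA ⟨1, by exact_mod_cast hm, by simp⟩ htam V' C' (by rw [hD]; exact hC'V') hgood' hap' V hgood
    hap hcong

set_option maxRecDepth 100000 in
/-- **(C1⁺_η) at `p = 5` for every good `a_5 = 0` globally minimal model `V` of the `5`-twist of `341775dm1`**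
(`[0, 0, 1, -1029000, -15531469]`; non-CM, `Im ρ̄ = C_ns⁺(5)`, rank `1`; Cremona: `Tam = 12`, `#Ш_an = 1`) BY THE CM-UNIT-ANCHOR
TRANSFER ROAD: the row is `5`-congruent to the unit sibling `A = [0,0,1,0,−405169]` of the class of `11025b1` (CM, `r_an = 0`,
`#Ш_an = 1`, `Tam = 6`; displayed `hLA hm htam`) — on the twist side the congruence `V′[5] ≃ V[5]` for ALL models is the kernel
record `EtaModFiveCongruenceRecords.modPCongruent_twist5_A11025_341775dm1` (the twisted row is the point `(λ:μ) = (-6300 : 1)`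
of the DIRECT Hesse family of the twisted anchor), conditional on Fisher's `thm132_geomTorsionFive_of_hesseFamily` only; at the
anchor's twist (C1⁺_η) and `μ = 0` are TREE THEOREMS (`EtaUnitRows`, `EtaMuBound`; mod `hmod hGZK hS28`); the transfer is the
OPEN binder `hCL` (Corpuz–Lei 2025 Thms 1–3 at `i = (p−1)/2`, PREPRINT). NO hypothesis on the row beyond its model: no rank, no
`L`-value, no shape of `L_5⁺`, no analytic `μ`, no Kobayashi Thm. 2.2/4.1, no Hatley–Lei, no Poitou–Tate, no Kitajima–Otsuki, no
(A), no `L₀`. Per-row instance of `EtaCMAnchorTransfer.quadraticBranchPlusEtaMainConjectureAt_of_cmUnitAnchor_of_transferFrame`;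
CONDITIONAL on `hCL` (PRE) and the named facts; nothing booked; BSD(W,5) claimed for no pair.
[claim: CorpuzLei2025, status: under-review] [cite: Fisher2012Hessian, Thm. 13.2 (i)]
[cite: Kobayashi2003, §4 Even main conjecture (p. 8)] [cite: GreenbergVatsal2000, Thm. (1.4)]
[cite: BurungaleFlach2024, Thm. 1.1 and Cor. 2] [cite: Cremona1997, Table 1 (label 341775dm1)] -/
theorem etaMC_341775dm1_5_cmAnchorTransfer (hCL : CorpuzLei2025_etaPlusMainConjecture_transfer_OPEN)
    (hmod : hasEntireLFunction_rat) (hGZK : rank_eq_analyticRank_of_analyticRank_le_one)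
    (hS28 : bsdTriple_of_hasCM_of_L_one_ne_zero) (hF : thm132_geomTorsionFive_of_hesseFamily)
    (W : WeierstrassCurve ℚ) (hW : W = ⟨0, 0, 1, (-1029000), (-15531469)⟩) (A : WeierstrassCurve ℚ) (hA : A = ⟨0, 0, 1, 0, (-405169)⟩)
    (hLA : A.entireLFunction 1 ≠ 0) (hm : shaAn A = ((1 : ℕ) : ℂ)) (htam : ¬ 5 ∣ A.tamagawaProduct) :
    ∀ (V' : WeierstrassCurve ℚ) [V'.IsElliptic] [V'.IsGloballyMinimal]
      (V : WeierstrassCurve ℚ) [V.IsElliptic] [V.IsGloballyMinimal] [Fact (5 : ℕ).Prime],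
      (∃ C' : VariableChange ℚ, C' • A.quadraticTwist (5) = V') →
      V'.HasGoodReductionAtPrime 5 → V'.frobeniusTrace 5 = 0 →
      (∃ C : VariableChange ℚ, C • W.quadraticTwist (5) = V) →
      V.HasGoodReductionAtPrime 5 → V.frobeniusTrace 5 = 0 →
      QuadraticBranchPlusEtaMainConjectureAt V 5 := by
  intro V' _ _ V _ _ _ hC' hgood' hap' hC hgood hap
  subst hW; subst hA
  haveI := EtaFineRoadRecords.isElliptic_A11025
  haveI := EtaFineRoadRecords.isGloballyMinimal_A11025
  haveI := EtaFineRoadRecords.isElliptic_341775dm1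
  have hcong : ModPCongruent V' V 5 :=
    EtaModFiveCongruenceRecords.modPCongruent_twist5_A11025_341775dm1 hF _ _ rfl rfl V' V hC' hC
  obtain ⟨C', hC'V'⟩ := hC'
  have hD : ((-1 : ℚ) ^ ((5 : ℕ) / 2) * ((5 : ℕ) : ℚ)) = 5 := by norm_num
  exact EtaCMAnchorTransfer.quadraticBranchPlusEtaMainConjectureAt_of_cmUnitAnchor_of_transferFrame 5 hCL hmod hGZK hS28
    (le_refl 5) _ EtaFineRoadRecords.hasCM_A11025 hLA ⟨1, by exact_mod_cast hm, by simp⟩ htam V' C' (by rw [hD]; exact hC'V') hgood' hap' V hgood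
    hap hcong

set_option maxRecDepth 100000 in
/-- **(C1⁺_η) at `p = 5` for every good `a_5 = 0` globally minimal model `V` of the `5`-twist of `404325g1`**
(`[0, 0, 1, -30778500, -65718132719]`; non-CM, `Im ρ̄ = C_ns⁺(5)`, rank `1`; Cremona: `Tam = 6`, `#Ш_an = 1`) BY THE
CM-UNIT-ANCHOR TRANSFER ROAD: the row is `5`-congruent to the unit sibling `A = [0,0,1,0,−169]` of the class of `675a1` (CM,
`r_an = 0`, `#Ш_an = 1`, `Tam = 1`; displayed `hLA hm htam`) — on the twist side the congruence `V′[5] ≃ V[5]` for ALL models is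
the kernel record `EtaModFiveCongruenceRecords.modPCongruent_twist5_A675_404325g1` (the twisted row is the point
`(λ:μ) = (1800 : 1)` of the DIRECT Hesse family of the twisted anchor), conditional on Fisher's
`thm132_geomTorsionFive_of_hesseFamily` only; at the anchor's twist (C1⁺_η) and `μ = 0` are TREE THEOREMS (`EtaUnitRows`,
`EtaMuBound`; mod `hmod hGZK hS28`); the transfer is the OPEN binder `hCL` (Corpuz–Lei 2025 Thms 1–3 at `i = (p−1)/2`,
PREPRINT). NO hypothesis on the row beyond its model: no rank, no `L`-value, no shape of `L_5⁺`, no analytic `μ`, no Kobayashi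
Thm. 2.2/4.1, no Hatley–Lei, no Poitou–Tate, no Kitajima–Otsuki, no (A), no `L₀`. Per-row instance of
`EtaCMAnchorTransfer.quadraticBranchPlusEtaMainConjectureAt_of_cmUnitAnchor_of_transferFrame`; CONDITIONAL on `hCL` (PRE) and
the named facts; nothing booked; BSD(W,5) claimed for no pair. [claim: CorpuzLei2025, status: under-review]
[cite: Fisher2012Hessian, Thm. 13.2 (i)] [cite: Kobayashi2003, §4 Even main conjecture (p. 8)]
[cite: GreenbergVatsal2000, Thm. (1.4)] [cite: BurungaleFlach2024, Thm. 1.1 and Cor. 2]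
[cite: Cremona1997, Table 1 (label 404325g1)] -/
theorem etaMC_404325g1_5_cmAnchorTransfer (hCL : CorpuzLei2025_etaPlusMainConjecture_transfer_OPEN)
    (hmod : hasEntireLFunction_rat) (hGZK : rank_eq_analyticRank_of_analyticRank_le_one)
    (hS28 : bsdTriple_of_hasCM_of_L_one_ne_zero) (hF : thm132_geomTorsionFive_of_hesseFamily)
    (W : WeierstrassCurve ℚ) (hW : W = ⟨0, 0, 1, (-30778500), (-65718132719)⟩) (A : WeierstrassCurve ℚ) (hA : A = ⟨0, 0, 1, 0, (-169)⟩)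
    (hLA : A.entireLFunction 1 ≠ 0) (hm : shaAn A = ((1 : ℕ) : ℂ)) (htam : ¬ 5 ∣ A.tamagawaProduct) :
    ∀ (V' : WeierstrassCurve ℚ) [V'.IsElliptic] [V'.IsGloballyMinimal]
      (V : WeierstrassCurve ℚ) [V.IsElliptic] [V.IsGloballyMinimal] [Fact (5 : ℕ).Prime],
      (∃ C' : VariableChange ℚ, C' • A.quadraticTwist (5) = V') →
      V'.HasGoodReductionAtPrime 5 → V'.frobeniusTrace 5 = 0 →
      (∃ C : VariableChange ℚ, C • W.quadraticTwist (5) = V) →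
      V.HasGoodReductionAtPrime 5 → V.frobeniusTrace 5 = 0 →
      QuadraticBranchPlusEtaMainConjectureAt V 5 := by
  intro V' _ _ V _ _ _ hC' hgood' hap' hC hgood hap
  subst hW; subst hA
  haveI := EtaFineRoadRecords.isElliptic_A675
  haveI := EtaFineRoadRecords.isGloballyMinimal_A675
  haveI := isElliptic_404325g1
  have hcong : ModPCongruent V' V 5 :=
    EtaModFiveCongruenceRecords.modPCongruent_twist5_A675_404325g1 hF _ _ rfl rfl V' V hC' hC
  obtain ⟨C', hC'V'⟩ := hC'
  have hD : ((-1 : ℚ) ^ ((5 : ℕ) / 2) * ((5 : ℕ) : ℚ)) = 5 := by norm_num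
  exact EtaCMAnchorTransfer.quadraticBranchPlusEtaMainConjectureAt_of_cmUnitAnchor_of_transferFrame 5 hCL hmod hGZK hS28
    (le_refl 5) _ EtaFineRoadRecords.hasCM_A675 hLA ⟨1, by exact_mod_cast hm, by simp⟩ htam V' C' (by rw [hD]; exact hC'V') hgood' hap' V hgood
    hap hcong

set_option maxRecDepth 100000 in
/-- **(C1⁺_η) at `p = 5` for every good `a_5 = 0` globally minimal model `V` of the `5`-twist of `417600gp1`**
(`[0, 0, 0, -34500, 5157000]`; non-CM, `Im ρ̄ = C_ns⁺(5)`, rank `1`; Cremona: `Tam = 4`, `#Ш_an = 1`) BY THE CM-UNIT-ANCHOR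
TRANSFER ROAD: the row is `5`-congruent to the unit sibling `A = [0,0,0,0,800]` of the class of `14400l1` (CM, `r_an = 0`,
`#Ш_an = 1`, `Tam = 2`; displayed `hLA hm htam`) — on the twist side the congruence `V′[5] ≃ V[5]` for ALL models is the kernel
record `EtaModFiveCongruenceRecords.modPCongruent_twist5_A14400_417600gp1` (the twisted row is the point `(λ:μ) = (-1200 : 1)`
of the INDIRECT Hesse family of the twisted anchor), conditional on Fisher's `thm58_geomTorsionFive_of_dualHesseFamily` only; at
the anchor's twist (C1⁺_η) and `μ = 0` are TREE THEOREMS (`EtaUnitRows`, `EtaMuBound`; mod `hmod hGZK hS28`); the transfer is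
the OPEN binder `hCL` (Corpuz–Lei 2025 Thms 1–3 at `i = (p−1)/2`, PREPRINT). NO hypothesis on the row beyond its model: no rank,
no `L`-value, no shape of `L_5⁺`, no analytic `μ`, no Kobayashi Thm. 2.2/4.1, no Hatley–Lei, no Poitou–Tate, no Kitajima–Otsuki,
no (A), no `L₀`. Per-row instance of
`EtaCMAnchorTransfer.quadraticBranchPlusEtaMainConjectureAt_of_cmUnitAnchor_of_transferFrame`; CONDITIONAL on `hCL` (PRE) and
the named facts; nothing booked; BSD(W,5) claimed for no pair. [claim: CorpuzLei2025, status: under-review]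
[cite: Fisher2013TwistsOfX5, Thm. 5.8] [cite: Kobayashi2003, §4 Even main conjecture (p. 8)]
[cite: GreenbergVatsal2000, Thm. (1.4)] [cite: BurungaleFlach2024, Thm. 1.1 and Cor. 2]
[cite: Cremona1997, Table 1 (label 417600gp1)] -/
theorem etaMC_417600gp1_5_cmAnchorTransfer (hCL : CorpuzLei2025_etaPlusMainConjecture_transfer_OPEN)
    (hmod : hasEntireLFunction_rat) (hGZK : rank_eq_analyticRank_of_analyticRank_le_one)
    (hS28 : bsdTriple_of_hasCM_of_L_one_ne_zero) (hF : thm58_geomTorsionFive_of_dualHesseFamily)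
    (W : WeierstrassCurve ℚ) (hW : W = ⟨0, 0, 0, (-34500), 5157000⟩) (A : WeierstrassCurve ℚ) (hA : A = ⟨0, 0, 0, 0, 800⟩)
    (hLA : A.entireLFunction 1 ≠ 0) (hm : shaAn A = ((1 : ℕ) : ℂ)) (htam : ¬ 5 ∣ A.tamagawaProduct) :
    ∀ (V' : WeierstrassCurve ℚ) [V'.IsElliptic] [V'.IsGloballyMinimal]
      (V : WeierstrassCurve ℚ) [V.IsElliptic] [V.IsGloballyMinimal] [Fact (5 : ℕ).Prime],
      (∃ C' : VariableChange ℚ, C' • A.quadraticTwist (5) = V') →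
      V'.HasGoodReductionAtPrime 5 → V'.frobeniusTrace 5 = 0 →
      (∃ C : VariableChange ℚ, C • W.quadraticTwist (5) = V) →
      V.HasGoodReductionAtPrime 5 → V.frobeniusTrace 5 = 0 →
      QuadraticBranchPlusEtaMainConjectureAt V 5 := by
  intro V' _ _ V _ _ _ hC' hgood' hap' hC hgood hap
  subst hW; subst hA
  haveI := EtaFineRoadRecords.isElliptic_A14400
  haveI := EtaFineRoadRecords.isGloballyMinimal_A14400
  haveI := EtaFineRoadRecords.isElliptic_417600gp1
  have hcong : ModPCongruent V' V 5 :=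
    EtaModFiveCongruenceRecords.modPCongruent_twist5_A14400_417600gp1 hF _ _ rfl rfl V' V hC' hC
  obtain ⟨C', hC'V'⟩ := hC'
  have hD : ((-1 : ℚ) ^ ((5 : ℕ) / 2) * ((5 : ℕ) : ℚ)) = 5 := by norm_num
  exact EtaCMAnchorTransfer.quadraticBranchPlusEtaMainConjectureAt_of_cmUnitAnchor_of_transferFrame 5 hCL hmod hGZK hS28
    (le_refl 5) _ EtaFineRoadRecords.hasCM_A14400 hLA ⟨1, by exact_mod_cast hm, by simp⟩ htam V' C' (by rw [hD]; exact hC'V') hgood' hap' V hgood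
    hap hcong

end EtaCMAnchorTransferRecords

end Summit.BirchSwinnertonDyer.BirchSwinnertonDyer.Theorems

end
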